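import Mathlib
import HarnessLib
import Summits.NavierStokesRegularity.NavierStokesRegularity.Theorems.TypeILiouvilleShorelineContinuation
import Summits.NavierStokesRegularity.NavierStokesRegularity.Theorems.TypeILiouvilleStrainLedgerStretchingFloor
import Literature.Analysis.FluidPDE.KNSSOseenMildDecayTools
import Literature.Analysis.FluidPDE.KNSSRegularityGalileanProofs

/-!
# TypeILiouvilleShorelineLocalSymmetry — crux (L) stmt-NavierStokesRegularity-10661 `TypeIliouvilleL`:
# LOCAL PERIODICITY / LOCAL STEADINESS OF A BOUNDED ANCIENT FLOW IS GLOBAL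

Helper for stmt-NavierStokesRegularity-10661 (`--supports`); theorems only, no definitions, no named-fact hypotheses;
closes no item; Navier–Stokes regularity is NOT proved here (leafhand seat of the EulerZoomLiouville route; sequel to
`TypeILiouvilleShorelineContinuation`).  Class P = print's class of bounded ancient mild solutions (continuous and
bounded on `(−∞,0) × ℝ³`, Oseen integral equation; weak divergence-freeness not needed here).

One-patch determination (`classP_eq_of_slice_locallyEq`) applied to the space-shifted, time-shifted and Euclidean
twins of a member, all of which lie in class P:
* `classP_spaceShift` — `x ↦ v t (x + p)` is in class P.
* `classP_spacePeriodic_of_locallyPeriodic` — `v t₀ (x + p) = v t₀ x` on ONE nonempty open set of ONE slice ⟹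
  `v t (x + p) = v t x` for all `t < 0`, `x`.
* `classP_timePeriodic_of_locallyPeriodic` — `v (t₀ + T) x = v t₀ x` (`T ≤ 0`) on one open patch of one slice ⟹
  `v (t + T) = v t` for all `t < 0`.
* `classP_steady_of_locallySteady` — **LOCALLY STEADY ⟹ STEADY**: if on one open patch `U` the slices `v (t₀ + T)`,
  `T ∈ (−δ, 0]`, all coincide with `v t₀`, then `v` is time-independent on `(−∞,0) × ℝ³` (periodicity with all small
  periods + analyticity of trajectories).
READING for the (L) residual: a counterexample to (L) that is locally periodic (in space or time) or locally steady
ANYWHERE is globally so — it then lives on the periodic / steady walls (KNSS 2009 p. 3: open even in the steady case),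
where the tree's sector theorems (`TypeILiouvilleRigidWaveSieve`, `…SteadySieve`) take over.
[cite: LemarieRieusset2016, Thm. 9.12 (PDF p. 260); KochNadirashviliSereginSverak2009, §1 p. 3 and §4 (arXiv:0709.3599)]
-/

noncomputable section
open MeasureTheory Filter Set Function Metric
open scoped Topology ENNReal
open Literature.Analysis Literature.Analysis.FluidPDE Literature.Analysis.UnboundedOperators
set_option linter.dupNamespace false
namespace Summit.NavierStokesRegularity.NavierStokesRegularity.Theorems.TypeILiouvilleShoreline

/-- **Class P is invariant under space translation**: `(t, x) ↦ v t (x + p)` is continuous and bounded on the slab and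
Oseen-mild (`heatExtension_comp_add_right_apply`, `oseenDuhamel_comp_add_right`); the `t₀ = 0` case of the tree's
`TypeILiouvilleQuiescentShadow.printClass_translate`, re-proved to keep the imports route-independent.
[cite: KochNadirashviliSereginSverak2009, §4 (arXiv:0709.3599)] -/
theorem classP_spaceShift
    {v : ℝ → EuclideanSpace ℝ (Fin 3) → EuclideanSpace ℝ (Fin 3)}
    (hc : ContinuousOn (uncurry v) (Iio 0 ×ˢ univ))
    (hK : ∃ K : ℝ, ∀ t < 0, ∀ x, ‖v t x‖ ≤ K)
    (hm : ∀ s t : ℝ, s < t → t < 0 → ∀ x,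
      v t x = heatExtension (v s) (t - s) x - oseenDuhamel 1 s v v t x)
    (p : EuclideanSpace ℝ (Fin 3)) :
    ContinuousOn (uncurry fun t x => v t (x + p)) (Iio 0 ×ˢ univ) ∧
    (∃ K : ℝ, ∀ t < 0, ∀ x, ‖v t (x + p)‖ ≤ K) ∧
    (∀ s t : ℝ, s < t → t < 0 → ∀ x,
      v t (x + p) = heatExtension (fun y => v s (y + p)) (t - s) x -
        oseenDuhamel 1 s (fun τ y => v τ (y + p)) (fun τ y => v τ (y + p)) t x) := by
  refine ⟨?_, ?_, fun s t hst ht x => ?_⟩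
  · have hmap : ContinuousOn (fun q : ℝ × EuclideanSpace ℝ (Fin 3) => (q.1, q.2 + p)) (Iio 0 ×ˢ univ) := by
      fun_prop
    have hmaps : MapsTo (fun q : ℝ × EuclideanSpace ℝ (Fin 3) => (q.1, q.2 + p)) (Iio 0 ×ˢ univ)
        (Iio 0 ×ˢ univ) := fun q hq => ⟨(mem_prod.1 hq).1, mem_univ _⟩
    exact (hc.comp hmap hmaps).congr fun q _ => rfl
  · obtain ⟨K, hKb⟩ := hK
    exact ⟨K, fun t ht x => hKb t ht _⟩
  · rw [hm s t hst ht (x + p), heatExtension_comp_add_right_apply, oseenDuhamel_comp_add_right]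

/-- **LOCAL SPATIAL PERIODICITY IS GLOBAL.**  If `v t₀ (x + p) = v t₀ x` for `x` in ONE nonempty open set at ONE time
`t₀ < 0`, then `v t (x + p) = v t x` for all `t < 0` and all `x` (one-patch determination for `v` and its
`p`-translate). [cite: LemarieRieusset2016, Thm. 9.12 (PDF p. 260)] -/
theorem classP_spacePeriodic_of_locallyPeriodic
    {v : ℝ → EuclideanSpace ℝ (Fin 3) → EuclideanSpace ℝ (Fin 3)}
    (hc : ContinuousOn (uncurry v) (Iio 0 ×ˢ univ))
    (hK : ∃ K : ℝ, ∀ t < 0, ∀ x, ‖v t x‖ ≤ K)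
    (hm : ∀ s t : ℝ, s < t → t < 0 → ∀ x,
      v t x = heatExtension (v s) (t - s) x - oseenDuhamel 1 s v v t x)
    (p : EuclideanSpace ℝ (Fin 3)) {t₀ : ℝ} (ht₀ : t₀ < 0)
    {U : Set (EuclideanSpace ℝ (Fin 3))} (hUo : IsOpen U) (hUne : U.Nonempty)
    (h : ∀ x ∈ U, v t₀ (x + p) = v t₀ x) :
    ∀ t < 0, ∀ x, v t (x + p) = v t x := by
  obtain ⟨hwc, hwK, hwm⟩ := classP_spaceShift hc hK hm p
  exact classP_eq_of_slice_locallyEq (u := fun t x => v t (x + p)) hwc hwK hwm hc hK hm ht₀ hUo hUne h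

/-- **LOCAL TIME PERIODICITY IS GLOBAL.**  If `v (t₀ + T) x = v t₀ x` (`T ≤ 0`) for `x` in ONE nonempty open set at ONE
time `t₀ < 0`, then `v (t + T) x = v t x` for all `t < 0`, `x` (one-patch determination for `v` and its time-shift,
which is in class P by `TypeILiouvilleStrainLedger.classP_timeShift`). [cite: LemarieRieusset2016, Thm. 9.12 (PDF p. 260)] -/
theorem classP_timePeriodic_of_locallyPeriodic
    {v : ℝ → EuclideanSpace ℝ (Fin 3) → EuclideanSpace ℝ (Fin 3)}
    (hc : ContinuousOn (uncurry v) (Iio 0 ×ˢ univ))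
    (hK : ∃ K : ℝ, ∀ t < 0, ∀ x, ‖v t x‖ ≤ K)
    (hd : ∀ t < 0, IsWeaklyDivFree (v t))
    (hm : ∀ s t : ℝ, s < t → t < 0 → ∀ x,
      v t x = heatExtension (v s) (t - s) x - oseenDuhamel 1 s v v t x)
    {T : ℝ} (hT : T ≤ 0) {t₀ : ℝ} (ht₀ : t₀ < 0)
    {U : Set (EuclideanSpace ℝ (Fin 3))} (hUo : IsOpen U) (hUne : U.Nonempty)
    (h : ∀ x ∈ U, v (t₀ + T) x = v t₀ x) :
    ∀ t < 0, ∀ x, v (t + T) x = v t x := by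
  obtain ⟨hwc, hwK, -, hwm⟩ := TypeILiouvilleStrainLedger.classP_timeShift hc hK hd hm hT
  exact classP_eq_of_slice_locallyEq (u := fun t x => v (t + T) x) hwc hwK hwm hc hK hm ht₀ hUo hUne h

/-- **LOCALLY STEADY ⟹ STEADY.**  If on ONE nonempty open set `U` the slices `v (t₀ + T)`, `T ∈ (−δ, 0]`, all agree
with `v t₀` (`t₀ < 0`, `δ > 0`), then `v` is time-independent on `(−∞,0) × ℝ³`: `v s x = v t x` for all `s, t < 0`.
(Each small `T` is a global period by `classP_timePeriodic_of_locallyPeriodic`; so every trajectory `t ↦ v t x` is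
constant on `(t₀ − δ, t₀]`, hence on `(−∞,0)` by analyticity — `classP_analyticOnNhd_time`.)  The (L) residual for such
members is the bounded STEADY Liouville problem. [cite: LemarieRieusset2016, Thm. 9.12; KochNadirashviliSereginSverak2009, §1 p. 3] -/
theorem classP_steady_of_locallySteady
    {v : ℝ → EuclideanSpace ℝ (Fin 3) → EuclideanSpace ℝ (Fin 3)}
    (hc : ContinuousOn (uncurry v) (Iio 0 ×ˢ univ))
    (hK : ∃ K : ℝ, ∀ t < 0, ∀ x, ‖v t x‖ ≤ K)
    (hd : ∀ t < 0, IsWeaklyDivFree (v t))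
    (hm : ∀ s t : ℝ, s < t → t < 0 → ∀ x,
      v t x = heatExtension (v s) (t - s) x - oseenDuhamel 1 s v v t x)
    {t₀ δ : ℝ} (ht₀ : t₀ < 0) (hδ : 0 < δ)
    {U : Set (EuclideanSpace ℝ (Fin 3))} (hUo : IsOpen U) (hUne : U.Nonempty)
    (h : ∀ T ∈ Ioc (-δ) 0, ∀ x ∈ U, v (t₀ + T) x = v t₀ x) :
    ∀ s < 0, ∀ t < 0, ∀ x, v s x = v t x := by
  -- every trajectory is constant `= v t₀ x` on `(−∞, 0)`
  have key : ∀ x, ∀ t < 0, v t x = v t₀ x := by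
    intro x
    have han := classP_analyticOnNhd_time hc hK hm x
    have ht₁ : t₀ - δ / 2 ∈ Ioo (t₀ - δ) t₀ := ⟨by linarith, by linarith⟩
    have hev : (fun τ => v τ x) =ᶠ[𝓝 (t₀ - δ / 2)] fun _ => v t₀ x := by
      filter_upwards [isOpen_Ioo.mem_nhds ht₁] with τ hτ
      have hT : τ - t₀ ∈ Ioc (-δ) 0 := ⟨by linarith [hτ.1], by linarith [hτ.2]⟩
      have hper := classP_timePeriodic_of_locallyPeriodic hc hK hd hm (T := τ - t₀) hT.2 ht₀ hUo hUne (h _ hT)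
      have := hper t₀ ht₀ x
      rw [show t₀ + (τ - t₀) = τ by ring] at this
      exact this
    intro t ht
    exact han.eqOn_of_preconnected_of_eventuallyEq analyticOnNhd_const (convex_Iio (0 : ℝ)).isPreconnected
      (mem_Iio.2 (by linarith [ht₁.2])) hev (mem_Iio.2 ht)
  intro s hs t ht x
  rw [key x s hs, key x t ht]

end Summit.NavierStokesRegularity.NavierStokesRegularity.Theorems.TypeILiouvilleShoreline

end
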